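import Summits.MatrixMultiplication.MatrixMultiplication.Theorems.AbelianSTPPCensusTAStatQNode
import Summits.MatrixMultiplication.MatrixMultiplication.Theorems.AbelianSTPPCensusTAStatKMemberXWalk5

/-!
# Static t*-certificate under a general Grynkiewicz budget constant: the k-member tree, root, order cover and bucket walk (data-free) + kernel-layout lemmas

Cell mm-stpp (rung F-M1), seat mm-stpp-vp-p2 (gen 8); census-silent kernel enabler (plan g20, HOME/STATUS 2026-08-28T22:53:43Z).  Node tests in
`AbelianSTPPCensusTAStatQNode.lean` (budget constant `bud`, guard `t0`).  This file is `TAStatKM.treeKX / rootKX / coverKX` (vp-p2 g6) and the bucket walk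
`TAStatKM.walk5` (g6/g7) over those tests — `treeKXQ`, `rootKXQ`, `coverKXQ`, `walkQ` — with case (i) `TAStatKM.goI`, the aggregates `TAStatKM.agg0/addM` and the
position form `TAStatKM.goIR` reused BY NAME (they do not read the budget), the walk's escape generalised to `tiOKB B` (loop `b < B`, sound for `V < B²`;
`TAStat2M.tiOK` = `B = 80`, `TAStatKM.tiOK90` = `B = 90`) and the one-member check `coverQ`; plus the bookkeeping a generator needs to assemble one (cell, order) tree
from separately compiled pieces exactly as in the ROOT-SPLIT layout of PRE-REG bands B1/B2⁺ (`…KMemberXSplit/XWalk/XWalk5.lean`): `treeKXQ_succ`, `treeKXQ_of_parts`,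
`treeKXQ_of_test`, `rootKXQ_of_parts`, `coverKXQ_of_forall/_append/_single/_at`, `walkQ_nil_eq/_cons_eq/_cons_of_or/_cons_of_coverKXQ/_cons_of_tiOKB`, `walkQ_sound`.
Soundness of the tree is `AbelianSTPPCensusTAStatQSound.lean`.
WHAT THIS IS NOT: no data table, no order range, no certificate is run; no statement about STPP families, no census number, no existence claim, no `ω`.
-/

set_option linter.dupNamespace false
set_option autoImplicit false

namespace Summit.MatrixMultiplication.MatrixMultiplication.Theorems.TAStatQ

open TECert (vol us)
open TAStat (Entry e0)
open TAStatKM (Agg agg0 addM goI goIR)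
open ShapeCert (D)

/-! ## The walk's escape, loop bound as a parameter -/

/-- integer test «every sorted shape `(a ≤ b ≤ c)` of volume `≤ V` has `a·b < t`», valid for `V < B²`: for every `b < B`, `min(b, ⌊V/b²⌋)·b < t`
(`TAStat2M.tiOK` is `B = 80`, `TAStatKM.tiOK90` is `B = 90`). [original] -/
def tiOKB (B V t : ℕ) : Bool := (List.range B).all fun b => Nat.blt (min b (V / (b * b)) * b) t

/-- Soundness of `tiOKB`: `a ≤ b`, `1 ≤ a`, `a·b·b ≤ V < B²` and `tiOKB B V t` give `a·b < t` (verbatim `TAStatKM.tiOK90_sound`). [original] -/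
theorem tiOKB_sound {B V t a b : ℕ} (h : tiOKB B V t = true) (ha : 1 ≤ a) (hab : a ≤ b) (hV : a * b * b ≤ V) (hVB : V < B * B) :
    a * b < t := by
  have hb1 : 1 ≤ b := le_trans ha hab
  have hbb : b * b ≤ V := le_trans (by
    calc b * b = 1 * b * b := by ring
      _ ≤ a * b * b := Nat.mul_le_mul_right _ (Nat.mul_le_mul_right _ ha)) hV
  have hbB : b < B := by
    by_contra hc; push Not at hc
    have : B * B ≤ b * b := Nat.mul_le_mul hc hc
    omega
  simp only [tiOKB, List.all_eq_true, List.mem_range, Nat.blt_eq] at h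
  have hb := h b hbB
  have hbpos : 0 < b * b := Nat.mul_pos (by omega) (by omega)
  have hadiv : a ≤ V / (b * b) := (Nat.le_div_iff_mul_le hbpos).2 (by
    calc a * (b * b) = a * b * b := by ring
      _ ≤ V := hV)
  have hamin : a ≤ min b (V / (b * b)) := le_min hab hadiv
  calc a * b ≤ min b (V / (b * b)) * b := Nat.mul_le_mul_right _ hamin
    _ < t := hb

/-! ## The tree (Bool checkers; data passed as parameters) -/

section Tree

variable (bud : ℕ → ℕ) (t0 : ℕ)
variable (tb : ℕ → ℕ) (m2 : ℕ → List (ℕ × ℕ × ℕ)) (gain : ℕ → ℕ) (row : ℕ → Entry) (xrow : ℕ → List (ℕ × ℕ × ℕ))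

/-- **The tree** below the root (fuel `n`), node test `testKXQ` (extras `xrow j`): case (i) over the allowed suffix (at most `kmax` explicit members, `TAStatKM.goI`)
AND case (ii) = descent to bucket `j − 1` (as `TAStatKM.treeKX`). [original] -/
def treeKXQ (g p V d al tl M kmax : ℕ) : ℕ → Agg → ℕ → List (ℕ × ℕ × ℕ) → Bool
  | 0, _, _, _ => false
  | n + 1, A, j, ms =>
    testKXQ bud t0 g p V d al tl A (tb j) (tb j) M (row j) false (xrow j) ||
      ((Nat.blt A.2.2.2.2.2 kmax && goI gain V (fun A' ms' => treeKXQ g p V d al tl M kmax n A' j ms') A ms) &&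
        match j with
        | 0 => false
        | j' + 1 => treeKXQ g p V d al tl M kmax n A j' (m2 j'))

/-- **The root** at bucket `j` (order `M`) for a maximal member whose own bucket is `j0 ≤ j` (as `TAStatKM.rootKX`, node test `testKXQ`). [original] -/
def rootKXQ (g p V d al tl M kmax j j0 : ℕ) : Bool :=
  testKXQ bud t0 g p V d al tl agg0 (tb j) (tb j) M (row j) true (xrow j) ||
    (goI gain V (fun A' ms' => treeKXQ bud t0 tb m2 gain row xrow g p V d al tl M kmax (kmax + j + 1) A' j ms') agg0 (m2 j) &&
      (Nat.blt j0 j ||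
        match j with
        | 0 => false
        | j' + 1 => treeKXQ bud t0 tb m2 gain row xrow g p V d al tl M kmax (kmax + j + 1) agg0 j' (m2 j')))

/-- the tree cover of the orders `[L, H]` at bucket `j`: the root passes at every order -/
def coverKXQ (g p V d al tl kmax j j0 L H : ℕ) : Bool :=
  (List.range (H + 1 - L)).all fun k => rootKXQ bud t0 tb m2 gain row xrow g p V d al tl (L + k) kmax j j0

variable (tp : ℕ → ℕ) (B : ℕ)

/-- Walk the buckets `j, j+1, …` of a table row (dropped to index `j`) for a maximal member whose own bucket is `j0`: escape once `tiOKB B V (TB[j])`, else the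
one-member `coverQ` at `t = TP[j]` or the tree cover `coverKXQ` (as `TAStatKM.walk5`). [original] -/
def walkQ (g p V d al tl kmax L H j0 : ℕ) : List Entry → ℕ → Bool
  | [], _ => true
  | e :: es, j => tiOKB B V (tb j) ||
      ((coverQ bud t0 g p V d (tp j) L H e || coverKXQ bud t0 tb m2 gain row xrow g p V d al tl kmax j j0 L H) &&
        walkQ g p V d al tl kmax L H j0 es (j + 1))

/-! ## Unfoldings and assembly from parts (equalities between Bool computations; no soundness content) -/

/-- one unfolding step of the tree [bookkeeping] -/
theorem treeKXQ_succ (g p V d al tl M kmax n : ℕ) (A : Agg) (j : ℕ) (ms : List (ℕ × ℕ × ℕ)) :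
    treeKXQ bud t0 tb m2 gain row xrow g p V d al tl M kmax (n + 1) A j ms =
      (testKXQ bud t0 g p V d al tl A (tb j) (tb j) M (row j) false (xrow j) ||
        ((Nat.blt A.2.2.2.2.2 kmax && goI gain V (fun A' ms' => treeKXQ bud t0 tb m2 gain row xrow g p V d al tl M kmax n A' j ms') A ms) &&
          match j with
          | 0 => false
          | j' + 1 => treeKXQ bud t0 tb m2 gain row xrow g p V d al tl M kmax n A j' (m2 j'))) := rfl

/-- the walk over an exhausted row passes [bookkeeping] -/
theorem walkQ_nil_eq (g p V d al tl kmax L H j0 j : ℕ) :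
    walkQ bud t0 tb m2 gain row xrow tp B g p V d al tl kmax L H j0 [] j = true := rfl

/-- one step of the walk, unfolded [bookkeeping] -/
theorem walkQ_cons_eq (g p V d al tl kmax L H j0 j : ℕ) (e : Entry) (es : List Entry) :
    walkQ bud t0 tb m2 gain row xrow tp B g p V d al tl kmax L H j0 (e :: es) j =
      (tiOKB B V (tb j) || ((coverQ bud t0 g p V d (tp j) L H e || coverKXQ bud t0 tb m2 gain row xrow g p V d al tl kmax j j0 L H) &&
        walkQ bud t0 tb m2 gain row xrow tp B g p V d al tl kmax L H j0 es (j + 1))) := rfl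

variable {bud t0 tb m2 gain row xrow tp B}

/-- **A node from its parts** (bucket `j' + 1`): case (i) established (e.g. from `TAStatKM.goIR` pieces via `TAStatKM.goI_of_goIR`) and the descent child's fact
give the node. [bookkeeping] -/
theorem treeKXQ_of_parts {g p V d al tl M kmax n : ℕ} {A : Agg} {j' : ℕ} {ms : List (ℕ × ℕ × ℕ)}
    (hk : Nat.blt A.2.2.2.2.2 kmax = true)
    (hgo : goI gain V (fun A' ms' => treeKXQ bud t0 tb m2 gain row xrow g p V d al tl M kmax n A' (j' + 1) ms') A ms = true)
    (hdesc : treeKXQ bud t0 tb m2 gain row xrow g p V d al tl M kmax n A j' (m2 j') = true) :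
    treeKXQ bud t0 tb m2 gain row xrow g p V d al tl M kmax (n + 1) A (j' + 1) ms = true := by
  have hunf : treeKXQ bud t0 tb m2 gain row xrow g p V d al tl M kmax (n + 1) A (j' + 1) ms =
      (testKXQ bud t0 g p V d al tl A (tb (j' + 1)) (tb (j' + 1)) M (row (j' + 1)) false (xrow (j' + 1)) ||
        ((Nat.blt A.2.2.2.2.2 kmax && goI gain V (fun A' ms' => treeKXQ bud t0 tb m2 gain row xrow g p V d al tl M kmax n A' (j' + 1) ms') A ms) &&
          treeKXQ bud t0 tb m2 gain row xrow g p V d al tl M kmax n A j' (m2 j'))) := rfl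
  rw [hunf, hk, hgo, hdesc]; simp

/-- a node whose TEST passes (any bucket, any fuel `n + 1`) [bookkeeping] -/
theorem treeKXQ_of_test {g p V d al tl M kmax n : ℕ} {A : Agg} {j : ℕ} {ms : List (ℕ × ℕ × ℕ)}
    (ht : testKXQ bud t0 g p V d al tl A (tb j) (tb j) M (row j) false (xrow j) = true) :
    treeKXQ bud t0 tb m2 gain row xrow g p V d al tl M kmax (n + 1) A j ms = true := by
  rw [treeKXQ_succ, ht]; simp

/-- a node at bucket `0` from case (i) alone is NOT available (case (ii) is `false` there); at bucket `0` with a passing case (i) the node still needs its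
test — this form records the general shape: test fails, case (i) passes, descent passes. [bookkeeping] -/
theorem treeKXQ_of_goI_desc {g p V d al tl M kmax n : ℕ} {A : Agg} {j' : ℕ} {ms : List (ℕ × ℕ × ℕ)}
    (hk : A.2.2.2.2.2 < kmax)
    (hgo : goI gain V (fun A' ms' => treeKXQ bud t0 tb m2 gain row xrow g p V d al tl M kmax n A' (j' + 1) ms') A ms = true)
    (hdesc : treeKXQ bud t0 tb m2 gain row xrow g p V d al tl M kmax n A j' (m2 j') = true) :
    treeKXQ bud t0 tb m2 gain row xrow g p V d al tl M kmax (n + 1) A (j' + 1) ms = true :=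
  treeKXQ_of_parts (by simpa using hk) hgo hdesc

/-- **The root from its parts** (bucket `j' + 1`, own bucket `j0`): case (i) over the complete list and — unless `j0 < j' + 1` — the descent child. [bookkeeping] -/
theorem rootKXQ_of_parts {g p V d al tl M kmax j' j0 : ℕ}
    (hgo : goI gain V (fun A' ms' => treeKXQ bud t0 tb m2 gain row xrow g p V d al tl M kmax (kmax + (j' + 1) + 1) A' (j' + 1) ms') agg0 (m2 (j' + 1)) = true)
    (hdesc : j0 < j' + 1 ∨ treeKXQ bud t0 tb m2 gain row xrow g p V d al tl M kmax (kmax + (j' + 1) + 1) agg0 j' (m2 j') = true) :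
    rootKXQ bud t0 tb m2 gain row xrow g p V d al tl M kmax (j' + 1) j0 = true := by
  simp only [rootKXQ, Bool.or_eq_true, Bool.and_eq_true, Nat.blt_eq]
  exact Or.inr ⟨hgo, hdesc⟩

/-- the root from its TEST [bookkeeping] -/
theorem rootKXQ_of_test {g p V d al tl M kmax j j0 : ℕ}
    (ht : testKXQ bud t0 g p V d al tl agg0 (tb j) (tb j) M (row j) true (xrow j) = true) :
    rootKXQ bud t0 tb m2 gain row xrow g p V d al tl M kmax j j0 = true := by
  simp only [rootKXQ, Bool.or_eq_true]
  exact Or.inl ht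

/-- the tree cover of an order interval from per-order root facts [bookkeeping] -/
theorem coverKXQ_of_forall {g p V d al tl kmax j j0 L H : ℕ}
    (h : ∀ k, k < H + 1 - L → rootKXQ bud t0 tb m2 gain row xrow g p V d al tl (L + k) kmax j j0 = true) :
    coverKXQ bud t0 tb m2 gain row xrow g p V d al tl kmax j j0 L H = true := by
  simp only [coverKXQ, List.all_eq_true, List.mem_range]
  exact h

/-- splitting an order interval of the tree cover in two [bookkeeping] -/
theorem coverKXQ_append {g p V d al tl kmax j j0 L K H : ℕ} (hLK : L ≤ K + 1) (hKH : K ≤ H)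
    (h1 : coverKXQ bud t0 tb m2 gain row xrow g p V d al tl kmax j j0 L K = true)
    (h2 : coverKXQ bud t0 tb m2 gain row xrow g p V d al tl kmax j j0 (K + 1) H = true) :
    coverKXQ bud t0 tb m2 gain row xrow g p V d al tl kmax j j0 L H = true := by
  simp only [coverKXQ, List.all_eq_true, List.mem_range] at h1 h2 ⊢
  intro k hk
  by_cases hc : L + k ≤ K
  · exact h1 k (by omega)
  · have := h2 (L + k - (K + 1)) (by omega)
    rwa [show K + 1 + (L + k - (K + 1)) = L + k by omega] at this

/-- the tree cover of a single order from the root fact at that order [bookkeeping] -/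
theorem coverKXQ_single {g p V d al tl kmax j j0 M : ℕ} (h : rootKXQ bud t0 tb m2 gain row xrow g p V d al tl M kmax j j0 = true) :
    coverKXQ bud t0 tb m2 gain row xrow g p V d al tl kmax j j0 M M = true := by
  simp only [coverKXQ, List.all_eq_true, List.mem_range]
  intro k hk
  have hk0 : k = 0 := by omega
  subst hk0
  simpa using h

/-- the tree cover at an order `M ∈ [L, H]` gives the root check at `M` [bookkeeping] -/
theorem coverKXQ_at {g p V d al tl kmax j j0 L H M : ℕ} (h : coverKXQ bud t0 tb m2 gain row xrow g p V d al tl kmax j j0 L H = true)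
    (hLM : L ≤ M) (hMH : M ≤ H) : rootKXQ bud t0 tb m2 gain row xrow g p V d al tl M kmax j j0 = true := by
  simp only [coverKXQ, List.all_eq_true, List.mem_range] at h
  have := h (M - L) (by omega)
  rwa [show L + (M - L) = M by omega] at this

/-- **A bucket from its parts, generic form**: the bucket passes by the one-member cover or by the tree cover (one Bool), and the rest of the walk passes. [bookkeeping] -/
theorem walkQ_cons_of_or {g p V d al tl kmax L H j0 j : ℕ} {e : Entry} {es : List Entry}
    (hc : (coverQ bud t0 g p V d (tp j) L H e || coverKXQ bud t0 tb m2 gain row xrow g p V d al tl kmax j j0 L H) = true)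
    (hw : walkQ bud t0 tb m2 gain row xrow tp B g p V d al tl kmax L H j0 es (j + 1) = true) :
    walkQ bud t0 tb m2 gain row xrow tp B g p V d al tl kmax L H j0 (e :: es) j = true := by
  rw [walkQ_cons_eq, hc, hw]; simp

/-- **A bucket from its parts, tree form**: the bucket's tree cover (assembled separately) and the rest of the walk give the walk. [bookkeeping] -/
theorem walkQ_cons_of_coverKXQ {g p V d al tl kmax L H j0 j : ℕ} {e : Entry} {es : List Entry}
    (hc : coverKXQ bud t0 tb m2 gain row xrow g p V d al tl kmax j j0 L H = true)
    (hw : walkQ bud t0 tb m2 gain row xrow tp B g p V d al tl kmax L H j0 es (j + 1) = true) :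
    walkQ bud t0 tb m2 gain row xrow tp B g p V d al tl kmax L H j0 (e :: es) j = true := by
  rw [walkQ_cons_eq, hc, hw]; simp

/-- **A bucket from its parts, one-member form**: the bucket's one-member cover and the rest of the walk give the walk. [bookkeeping] -/
theorem walkQ_cons_of_coverQ {g p V d al tl kmax L H j0 j : ℕ} {e : Entry} {es : List Entry}
    (hc : coverQ bud t0 g p V d (tp j) L H e = true)
    (hw : walkQ bud t0 tb m2 gain row xrow tp B g p V d al tl kmax L H j0 es (j + 1) = true) :
    walkQ bud t0 tb m2 gain row xrow tp B g p V d al tl kmax L H j0 (e :: es) j = true := by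
  rw [walkQ_cons_eq, hc, hw]; simp

/-- a bucket at which the walk escapes (`tiOKB`) [bookkeeping] -/
theorem walkQ_cons_of_tiOKB {g p V d al tl kmax L H j0 j : ℕ} {e : Entry} {es : List Entry} (h : tiOKB B V (tb j) = true) :
    walkQ bud t0 tb m2 gain row xrow tp B g p V d al tl kmax L H j0 (e :: es) j = true := by
  rw [walkQ_cons_eq, h]; simp

/-! ## Soundness of the walk -/

/-- Soundness of the walk: if no bucket `j + k'`, `k' ≤ k`, escapes, then at bucket `j + k` the one-member `coverQ` passes at `t = TP[j+k]` or the tree cover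
passes (as `TAStatKM.walk5_sound`). [bookkeeping] -/
theorem walkQ_sound (g p V d al tl kmax L H j0 : ℕ) : ∀ (es : List Entry) (j : ℕ),
    walkQ bud t0 tb m2 gain row xrow tp B g p V d al tl kmax L H j0 es j = true →
    ∀ k, k < es.length → (∀ k', k' ≤ k → tiOKB B V (tb (j + k')) = false) →
      coverQ bud t0 g p V d (tp (j + k)) L H (es.getD k e0) = true ∨
        coverKXQ bud t0 tb m2 gain row xrow g p V d al tl kmax (j + k) j0 L H = true
  | [], j, _, k, hk, _ => by simp at hk
  | e :: es, j, h, k, hk, hsmall => by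
    rw [walkQ_cons_eq, Bool.or_eq_true, Bool.and_eq_true, Bool.or_eq_true] at h
    rcases h with hstop | ⟨hc, hrest⟩
    · have h0 := hsmall 0 (Nat.zero_le _)
      simp only [Nat.add_zero] at h0
      rw [h0] at hstop
      exact absurd hstop Bool.false_ne_true
    · cases k with
      | zero => simpa using hc
      | succ k =>
        have hk' : k < es.length := by simpa using hk
        have := walkQ_sound g p V d al tl kmax L H j0 es (j + 1) hrest k hk' (fun k' hk'' => by
          have := hsmall (k' + 1) (by omega)
          simpa [Nat.add_right_comm j 1 k', Nat.add_assoc] using this)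
        simpa [Nat.add_right_comm j 1 k, Nat.add_assoc] using this

end Tree

end Summit.MatrixMultiplication.MatrixMultiplication.Theorems.TAStatQ
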